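import Mathlib
import Literature.Combinatorics.Enumerative.AperyNumbers
import Literature.Combinatorics.Enumerative.AperyNumbersZetaTwo
import Literature.Combinatorics.Enumerative.AperyLucasCongruences
import Literature.NumberTheory.Congruences.LjunggrenBinomialCongruence
import HarnessLib

/-!
# The supercongruence `a_{pn} ≡ a_n (mod p³)` for the Apéry numbers (Gessel 1982, Theorem 3 (i))

Topic `Literature/Combinatorics/Enumerative`.  Everything in this file is PROVED (no named facts).

## Source, as printed — I. Gessel, *Some congruences for Apéry numbers*, J. Number Theory **14** (1982)
362–368 [Gessel1982] (held text `paper:doi-10-1016-0022-314x-82-90071-3`, pp. 364–365):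

«THEOREM 3. (i) For `p` prime, `p > 3`, `a_{pn} ≡ a_n (mod p³)`.»  Here
`a_n = Σ_{k=0}^{n} C(n,k)² C(n+k,k)²` are the Apéry numbers (the tree's `AperyNumbers.aperyNumber`).
Gessel's proof (p. 364–365): «We have `a_{pn} = S₁ + S₂`, where `S₁ = Σ_k C(pn,pk)² C(pn+pk,pk)²` and
`S₂` is the sum of the remaining terms.  It is known [5] (Kazandzidis) that for `p > 3`,
`C(pa,pb) ≡ C(a,b) (mod p³)`.  Thus for `p > 3` we have `S₁ ≡ a_n (mod p³)` … for `0 < k < p` we have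
`C(pn, pm+k)² ≡ p² n² C(n−1,m)²/k² · (…)`, … For `p > 3`, `Σ_{k=1}^{p−1} (1/k²)` is divisible by `p`
[4, p. 90], so `S₂ ≡ 0 (mod p³)`.  This completes the proof of (i).»

The same two-block computation proves, verbatim, `A_{2,s}(pn) ≡ A_{2,s}(n) (mod p³)` for every sum
`A_{2,s}(n) = Σ_k C(n,k)² C(n+k,k)^s` (`s ≥ 0`; the tree's `AperyLucasCongruences.genApery 2 s`):
the case `s = 1` is the supercongruence for Apéry's `ζ(2)` numbers `u_n = Σ_k C(n,k)² C(n+k,k)`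
(the tree's `AperyNumbersZetaTwo.apery2Number`), in print as the case `r = 1` of M. Coster's two-term
supercongruence `u(mp^r) ≡ u(mp^{r−1}) (mod p^{3r})` [Coster1988] — attribution as reported in
R. Osburn, B. Sahu, A. Straub, *Supercongruences for sporadic sequences*, Proc. Edinb. Math. Soc. **59**
(2016) [OsburnSahuStraub2016] §4 (held text `paper:arxiv-1312.2195` p. 9: «Cases A and D have been proven by
Coster») and proved again as the diagonal case of eq. (25) of A. Straub, *Multivariate Apéry numbers and
supercongruences of rational functions*, Algebra Number Theory **8** (2014) [Straub2014] (held text p. 8: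
«the supercongruences `B(p^r n) ≡ B(p^{r−1} n) (mod p^{3r})` hold for all primes `p ≥ 5`.  In the diagonal
case `n₁ = n₂ = n₃`, this result was first proved by Coster [Cos88]»).

## What is formalised (everything PROVED)

* `choose_digit_term_modEq` — the digit terms: `C(np,jp)² C(np+jp,jp)^s ≡ C(n,j)² C(n+j,j)^s (mod p³)`
  (two applications of the tree's Ljunggren/Kazandzidis congruence `Ljunggren.choose_mul_prime`);
* `pow_three_dvd_offDigit_block` — the off-digit blocks: `p³ ∣ Σ_{0<i<p} C(np,jp+i)² C(np+jp+i,jp+i)^s`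
  for `j < n` (Gessel's `S₂`-computation: `K·C(np,K) = np·C(np−1,K−1)`, Lucas, Wilson and
  `Σ_{0<i<p} i⁻² ≡ 0 (mod p)` for `p > 3`);
* **`genApery_two_modEq_mul_prime`** — `A_{2,s}(np) ≡ A_{2,s}(n) (mod p³)` for every prime `p > 3`,
  every `s` and every `n`;
* **`aperyNumber_modEq_mul_prime`** = Gessel's Theorem 3 (i) as printed, with the divisibility form
  `pow_three_dvd_aperyNumber_mul_prime_sub`; **`apery2Number_modEq_mul_prime`** = the `ζ(2)` companion
  (Coster), with `pow_three_dvd_apery2Number_mul_prime_sub`;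
* the term-level forms for the Apéry numbers: `pow_three_dvd_aperyTerm_digit_sub` (digit terms) and
  `pow_three_dvd_sum_aperyTerm_offDigit` (off-digit blocks).

Not covered: Gessel's Theorem 3 (ii)–(iii) (`a_n ≡ 5^n (mod 8)`, the Lucas congruence modulo `9`),
Theorem 4 (the `mod p²` shifts `a_{k+pn}`), and the prime-power two-term supercongruences
`A(mp^r) ≡ A(mp^{r−1}) (mod p^{3r})`, `r ≥ 2`, of Beukers 1985 / Coster 1988.  Nearest existing
declarations (used, not restated): `AperyLucasCongruences.genApery`, `….cast_choose_digit`,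
`….cast_choose_shift_digit` (Lucas), `Ljunggren.choose_mul_prime`, Mathlib's `ZMod.wilsons_lemma` and
`FiniteField.sum_pow_lt_card_sub_one`.
-/

namespace Literature.Combinatorics.Enumerative.AperySupercongruences

open Finset Nat
open AperyLucasCongruences (genApery genApery_two_two genApery_two_one cast_choose_digit
  cast_choose_shift_digit)
open Literature.NumberTheory.Congruences (Ljunggren.choose_mul_prime)

/-! ## Elementary lemmas modulo `p` -/

/-- Splitting a sum over `range (k·q)` into `q`-blocks: `Σ_{x < kq} f x = Σ_{j < k} Σ_{i < q} f(jq+i)`.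
[folklore] -/
private theorem sum_range_mul {M : Type*} [AddCommMonoid M] (f : ℕ → M) (q : ℕ) :
    ∀ k : ℕ, ∑ x ∈ range (k * q), f x = ∑ j ∈ range k, ∑ i ∈ range q, f (j * q + i)
  | 0 => by simp
  | k + 1 => by
      rw [Finset.sum_range_succ (fun j => ∑ i ∈ range q, f (j * q + i)) k, ← sum_range_mul f q k,
        add_mul, one_mul, Finset.sum_range_add]

section modp

variable {p : ℕ} [hp : Fact p.Prime]

/-- `C(p−1, k) ≡ (−1)^k (mod p)` for `k < p` (from `C(p,k+1) = C(p−1,k) + C(p−1,k+1) ≡ 0`).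
[cite: Gessel1982, Thm 3 (proof: «It is easily seen that C(pn−1, k) ≡ (−1)^k (mod p)»)] -/
theorem cast_choose_prime_sub_one : ∀ {k : ℕ}, k < p → (((p - 1).choose k : ℕ) : ZMod p) = (-1) ^ k
  | 0, _ => by simp
  | k + 1, hk => by
    have ih := cast_choose_prime_sub_one (k := k) (by omega)
    have hpas : p.choose (k + 1) = (p - 1).choose k + (p - 1).choose (k + 1) := by
      have h := Nat.choose_succ_succ' (p - 1) k
      rwa [Nat.sub_add_cancel hp.out.one_le] at h
    have hdvd : p ∣ p.choose (k + 1) := hp.out.dvd_choose_self (Nat.succ_ne_zero k) hk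
    have h0 : ((p.choose (k + 1) : ℕ) : ZMod p) = 0 := (ZMod.natCast_eq_zero_iff _ _).2 hdvd
    rw [hpas, Nat.cast_add, ih] at h0
    rw [pow_succ]
    linear_combination h0

/-- A sum over `ZMod p` is the sum over the representatives `0, …, p − 1`. [folklore] -/
private theorem sum_zmod_eq_sum_range {β : Type*} [AddCommMonoid β] (f : ZMod p → β) :
    ∑ x : ZMod p, f x = ∑ m ∈ range p, f (m : ZMod p) := by
  refine (Finset.sum_nbij' (fun m : ℕ ↦ (m : ZMod p)) (fun x : ZMod p ↦ x.val) ?_ ?_ ?_ ?_ ?_).symm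
  · intro m _; exact Finset.mem_univ _
  · intro x _; exact Finset.mem_range.mpr (ZMod.val_lt x)
  · intro m hm; exact ZMod.val_cast_of_lt (Finset.mem_range.mp hm)
  · intro x _; exact ZMod.natCast_zmod_val x
  · intro m _; rfl

/-- For a prime `p > 3`: `Σ_{0<i<p} i⁻² = 0` in `ℤ/pℤ` (inversion permutes the non-zero residues and
`Σ_{i<p} i² = (p−1)p(2p−1)/6 ≡ 0`).
[cite: Gessel1982, Thm 3 (proof: «For p > 3, Σ_{k=1}^{p−1} 1/k² is divisible by p [4, p. 90]»)] -/
theorem sum_Ico_inv_sq_eq_zero (h3 : 3 < p) :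
    ∑ i ∈ Ico 1 p, ((i : ZMod p)⁻¹) ^ 2 = 0 := by
  -- extend the sum to all of `ℤ/pℤ` (the term `i = 0` vanishes) and invert `x ↦ x⁻¹`
  have h1 : ∑ x : ZMod p, (x⁻¹) ^ 2 = ∑ i ∈ Ico 1 p, ((i : ZMod p)⁻¹) ^ 2 := by
    rw [sum_zmod_eq_sum_range, Finset.range_eq_Ico, Finset.sum_eq_sum_Ico_succ_bot hp.out.pos]
    simp
  have h2 : ∑ x : ZMod p, (x⁻¹) ^ 2 = ∑ x : ZMod p, x ^ 2 :=
    Fintype.sum_bijective _ inv_involutive.bijective _ _ fun _ ↦ rfl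
  rw [← h1, h2]
  exact FiniteField.sum_pow_lt_card_sub_one (ZMod p) 2 (by rw [ZMod.card]; omega)

/-- `0 < i < p` is non-zero modulo `p`. [folklore] -/
private theorem natCast_ne_zero_of_mem_Ico {i : ℕ} (hi : i ∈ Ico 1 p) : (i : ZMod p) ≠ 0 := by
  rw [Finset.mem_Ico] at hi
  rw [Ne, ZMod.natCast_eq_zero_iff]
  intro h
  have := Nat.le_of_dvd (by omega) h
  omega

/-- Wilson: for `0 < i < p`, `∏_{0<i'<p, i'≠i} i' = (p−1)!/i ≡ −i⁻¹ (mod p)`. [folklore] -/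
private theorem prod_Ico_erase_natCast {i : ℕ} (hi : i ∈ Ico 1 p) :
    ∏ i' ∈ (Ico 1 p).erase i, ((i' : ℕ) : ZMod p) = -((i : ZMod p)⁻¹) := by
  have hi0 := natCast_ne_zero_of_mem_Ico hi
  have hprod : (∏ i' ∈ (Ico 1 p).erase i, ((i' : ℕ) : ZMod p)) * (i : ZMod p) = -1 := by
    rw [Finset.prod_erase_mul _ _ hi]
    have hI : Ico 1 p = Ico 1 (p - 1 + 1) := by rw [Nat.sub_add_cancel hp.out.one_le]
    rw [hI, ← Nat.cast_prod, Finset.prod_Ico_id_eq_factorial, ZMod.wilsons_lemma]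
  calc ∏ i' ∈ (Ico 1 p).erase i, ((i' : ℕ) : ZMod p)
      = (∏ i' ∈ (Ico 1 p).erase i, ((i' : ℕ) : ZMod p)) * (i : ZMod p) * (i : ZMod p)⁻¹ := by
        rw [mul_assoc, mul_inv_cancel₀ hi0, mul_one]
    _ = -((i : ZMod p)⁻¹) := by rw [hprod, neg_one_mul]

/-- The symmetric-function sum behind Gessel's `S₂`: for a prime `p > 3`,
`Σ_{0<i<p} ∏_{0<i'<p, i'≠i} i'² ≡ Σ_{0<i<p} i⁻² ≡ 0 (mod p)`. [folklore] -/
private theorem sum_prod_erase_sq_eq_zero (h3 : 3 < p) :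
    ∑ i ∈ Ico 1 p, ∏ i' ∈ (Ico 1 p).erase i, ((i' : ℕ) : ZMod p) ^ 2 = 0 := by
  rw [← sum_Ico_inv_sq_eq_zero (p := p) h3]
  refine Finset.sum_congr rfl fun i hi ↦ ?_
  rw [Finset.prod_pow, prod_Ico_erase_natCast hi, neg_sq]

end modp

/-! ## The two blocks of `A_{2,s}(np)` -/

section blocks

variable {p : ℕ}

/-- **Digit terms** (Gessel's `S₁`): for a prime `p > 3`,
`C(np,jp)² C(np+jp,jp)^s ≡ C(n,j)² C(n+j,j)^s (mod p³)` — Kazandzidis/Ljunggren `C(pa,pb) ≡ C(a,b) (mod p³)`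
twice. [cite: Gessel1982, Thm 3 (proof: «S₁ ≡ a_n (mod p³)»)] -/
theorem choose_digit_term_modEq (hp : p.Prime) (h3 : 3 < p) (s n j : ℕ) :
    (((n * p).choose (j * p) : ℕ) : ℤ) ^ 2 * ((((n * p + j * p).choose (j * p)) : ℕ) : ℤ) ^ s
      ≡ ((n.choose j : ℕ) : ℤ) ^ 2 * ((((n + j).choose j) : ℕ) : ℤ) ^ s [ZMOD (p : ℤ) ^ 3] := by
  have h1 := Ljunggren.choose_mul_prime hp h3 n j
  have h2 := Ljunggren.choose_mul_prime hp h3 (n + j) j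
  rw [add_mul] at h2
  exact (h1.pow 2).mul (h2.pow s)

/-- `jp + i` is prime to `p` for `0 < i < p`. [folklore] -/
private theorem coprime_mul_add (hp : p.Prime) (j : ℕ) {i : ℕ} (hi : i ∈ Ico 1 p) :
    Nat.Coprime (j * p + i) p := by
  rw [Finset.mem_Ico] at hi
  rw [Nat.coprime_comm, Nat.Prime.coprime_iff_not_dvd hp]
  intro h
  have hi' : p ∣ i := (Nat.dvd_add_right (dvd_mul_left p j)).1 h
  have := Nat.le_of_dvd (by omega) hi'
  omega

/-- **Off-digit blocks** (Gessel's `S₂`): for a prime `p > 3` and `j < n`,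
`p³ ∣ Σ_{0<i<p} C(np, jp+i)² C(np+jp+i, jp+i)^s`.  Proof as printed: with `K = jp+i`,
`K·C(np,K) = np·C(np−1,K−1)`, so the block times the unit `∏_i K_i²` equals `p²·M` with
`M ≡ n² C(n−1,j)² C(n+j,j)^s · Σ_{0<i<p} i⁻² ≡ 0 (mod p)` (Lucas, `C(p−1,i−1)² ≡ 1`, Wilson).
[cite: Gessel1982, Thm 3 (proof: «so S₂ ≡ 0 (mod p³)»)] -/
theorem pow_three_dvd_offDigit_block (hp : p.Prime) (h3 : 3 < p) (s : ℕ) {n j : ℕ} (hjn : j < n) :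
    p ^ 3 ∣ ∑ i ∈ Ico 1 p, (n * p).choose (j * p + i) ^ 2 * (n * p + (j * p + i)).choose (j * p + i) ^ s := by
  haveI := Fact.mk hp
  have hp1 : 1 ≤ p := hp.one_lt.le
  have hn : 1 ≤ n := by omega
  have hnp : n * p - 1 + 1 = n * p := Nat.sub_add_cancel (Nat.one_le_iff_ne_zero.2 (by positivity))
  -- the absorption identity `K · C(np, K) = np · C(np−1, K−1)` for `K = jp+i`, `i ≥ 1`
  have habs : ∀ i ∈ Ico 1 p,
      (j * p + i) * (n * p).choose (j * p + i) = n * p * (n * p - 1).choose (j * p + i - 1) := by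
    intro i hi
    rw [Finset.mem_Ico] at hi
    have h := Nat.add_one_mul_choose_eq (n * p - 1) (j * p + i - 1)
    rw [hnp, show j * p + i - 1 + 1 = j * p + i by omega] at h
    rw [h, mul_comm]
  -- the unit `W = ∏ K_i²` and the integer `M`
  set W : ℕ := ∏ i ∈ Ico 1 p, (j * p + i) ^ 2 with hW
  set M : ℕ := ∑ i ∈ Ico 1 p, (∏ i' ∈ (Ico 1 p).erase i, (j * p + i') ^ 2) *
      (n ^ 2 * (n * p - 1).choose (j * p + i - 1) ^ 2 * (n * p + (j * p + i)).choose (j * p + i) ^ s)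
    with hM
  have hWB : W * ∑ i ∈ Ico 1 p, (n * p).choose (j * p + i) ^ 2 *
      (n * p + (j * p + i)).choose (j * p + i) ^ s = p ^ 2 * M := by
    rw [hM, Finset.mul_sum, Finset.mul_sum]
    refine Finset.sum_congr rfl fun i hi ↦ ?_
    rw [hW, ← Finset.mul_prod_erase _ _ hi]
    have h := habs i hi
    calc (j * p + i) ^ 2 * (∏ i' ∈ (Ico 1 p).erase i, (j * p + i') ^ 2) *
          ((n * p).choose (j * p + i) ^ 2 * (n * p + (j * p + i)).choose (j * p + i) ^ s)
        = (∏ i' ∈ (Ico 1 p).erase i, (j * p + i') ^ 2) *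
            ((j * p + i) * (n * p).choose (j * p + i)) ^ 2 *
            (n * p + (j * p + i)).choose (j * p + i) ^ s := by ring
      _ = p ^ 2 * ((∏ i' ∈ (Ico 1 p).erase i, (j * p + i') ^ 2) *
            (n ^ 2 * (n * p - 1).choose (j * p + i - 1) ^ 2 *
              (n * p + (j * p + i)).choose (j * p + i) ^ s)) := by rw [h]; ring
  -- `M ≡ 0 (mod p)`: every summand reduces by Lucas and Wilson
  have hMp : p ∣ M := by
    rw [← ZMod.natCast_eq_zero_iff, hM, Nat.cast_sum]
    have hterm : ∀ i ∈ Ico 1 p,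
        (((∏ i' ∈ (Ico 1 p).erase i, (j * p + i') ^ 2) *
          (n ^ 2 * (n * p - 1).choose (j * p + i - 1) ^ 2 *
            (n * p + (j * p + i)).choose (j * p + i) ^ s) : ℕ) : ZMod p)
        = ((n : ZMod p) ^ 2 * (((n - 1).choose j : ℕ) : ZMod p) ^ 2 *
            ((((n + j).choose j) : ℕ) : ZMod p) ^ s) *
          ∏ i' ∈ (Ico 1 p).erase i, ((i' : ℕ) : ZMod p) ^ 2 := by
      intro i hi
      rw [Finset.mem_Ico] at hi
      -- Lucas for `C(np−1, jp+i−1)` with `np−1 = (n−1)p + (p−1)`, `jp+i−1 = jp + (i−1)`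
      have hL1 : (((n * p - 1).choose (j * p + i - 1) : ℕ) : ZMod p)
          = (((n - 1).choose j : ℕ) : ZMod p) * (-1) ^ (i - 1) := by
        have e1 : n * p - 1 = (n - 1) * p + (p - 1) := by
          zify [hn, hp1, Nat.one_le_iff_ne_zero.2 (show n * p ≠ 0 by positivity)]
          ring
        have e2 : j * p + i - 1 = j * p + (i - 1) := by omega
        rw [e1, e2, cast_choose_digit (n - 1) (p - 1) j (i - 1) (by omega) (by omega),
          cast_choose_prime_sub_one (by omega)]
      -- Gessel's variant of Lucas for `C(np + jp + i, jp + i)`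
      have hL2 : (((n * p + (j * p + i)).choose (j * p + i) : ℕ) : ZMod p)
          = ((((n + j).choose j) : ℕ) : ZMod p) := by
        have h := cast_choose_shift_digit (p := p) n 0 j i hp.pos hi.2
        rwa [add_zero, zero_add, Nat.choose_self, Nat.cast_one, mul_one] at h
      -- the shifted factors `jp + i' ≡ i'`
      have hsq : ((-1 : ZMod p) ^ (i - 1)) ^ 2 = 1 := by
        rw [← pow_mul, mul_comm, pow_mul, neg_one_sq, one_pow]
      push_cast
      rw [hL1, hL2]
      simp only [ZMod.natCast_self, mul_zero, zero_add]
      linear_combination ((n : ZMod p) ^ 2 * (((n - 1).choose j : ℕ) : ZMod p) ^ 2 *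
        ((((n + j).choose j) : ℕ) : ZMod p) ^ s * ∏ i' ∈ (Ico 1 p).erase i, ((i' : ℕ) : ZMod p) ^ 2) * hsq
    rw [Finset.sum_congr rfl hterm, ← Finset.mul_sum, sum_prod_erase_sq_eq_zero h3, mul_zero]
  -- `p³ ∣ W · block` and `W` is prime to `p`
  have hcop : Nat.Coprime (p ^ 3) W := by
    refine Nat.Coprime.pow_left 3 ?_
    rw [hW]
    exact Nat.Coprime.prod_right fun i hi ↦ Nat.Coprime.pow_right 2 (coprime_mul_add hp j hi).symm
  refine hcop.dvd_of_dvd_mul_left ?_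
  rw [hWB, pow_succ]
  exact Nat.mul_dvd_mul_left (p ^ 2) hMp

end blocks

/-! ## The supercongruence for `A_{2,s}` and for the Apéry numbers of both kinds -/

section main

variable {p : ℕ}

/-- **`A_{2,s}(np) ≡ A_{2,s}(n) (mod p³)`** for every prime `p > 3`, every `s ≥ 0` and every `n`
(Gessel's proof of Theorem 3 (i), which is the case `s = 2`, applies verbatim).
[cite: Gessel1982, Thm 3 (i) (proof)] -/
theorem genApery_two_modEq_mul_prime (hp : p.Prime) (h3 : 3 < p) (s n : ℕ) :
    ((genApery 2 s (n * p) : ℕ) : ℤ) ≡ (genApery 2 s n : ℕ) [ZMOD (p : ℤ) ^ 3] := by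
  -- split `A_{2,s}(np)` into digit terms `K = jp` (`j ≤ n`) and off-digit blocks (`j < n`)
  have hdec : genApery 2 s (n * p) =
      ∑ j ∈ range n, ((n * p).choose (j * p) ^ 2 * (n * p + j * p).choose (j * p) ^ s +
        ∑ i ∈ Ico 1 p, (n * p).choose (j * p + i) ^ 2 * (n * p + (j * p + i)).choose (j * p + i) ^ s) +
      (n * p).choose (n * p) ^ 2 * (n * p + n * p).choose (n * p) ^ s := by
    unfold genApery
    rw [Finset.sum_range_succ, sum_range_mul _ p n]
    congr 1
    refine Finset.sum_congr rfl fun j _ ↦ ?_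
    rw [Finset.range_eq_Ico, Finset.sum_eq_sum_Ico_succ_bot hp.pos, add_zero]
  have hdec' : genApery 2 s n =
      ∑ j ∈ range n, n.choose j ^ 2 * (n + j).choose j ^ s + n.choose n ^ 2 * (n + n).choose n ^ s := by
    unfold genApery
    rw [Finset.sum_range_succ]
  rw [hdec, hdec']
  push_cast
  refine Int.ModEq.add (Int.ModEq.sum fun j hj ↦ ?_) ?_
  · -- digit term plus off-digit block
    have hblock : ((∑ i ∈ Ico 1 p, (n * p).choose (j * p + i) ^ 2 *
        (n * p + (j * p + i)).choose (j * p + i) ^ s : ℕ) : ℤ) ≡ 0 [ZMOD (p : ℤ) ^ 3] := by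
      rw [Int.modEq_zero_iff_dvd, ← Nat.cast_pow]
      exact Int.natCast_dvd_natCast.2 (pow_three_dvd_offDigit_block hp h3 s (Finset.mem_range.1 hj))
    push_cast at hblock
    have h := (choose_digit_term_modEq hp h3 s n j).add hblock
    rwa [add_zero] at h
  · -- the last digit term `K = np`
    exact choose_digit_term_modEq hp h3 s n n

/-- **Gessel 1982, Theorem 3 (i)**: for a prime `p > 3` and every `n`, `a_{pn} ≡ a_n (mod p³)` for the
Apéry numbers `a_n = Σ_k C(n,k)² C(n+k,k)²`. [cite: Gessel1982, Thm 3 (i)] -/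
theorem aperyNumber_modEq_mul_prime (hp : p.Prime) (h3 : 3 < p) (n : ℕ) :
    ((AperyNumbers.aperyNumber (n * p) : ℕ) : ℤ) ≡ (AperyNumbers.aperyNumber n : ℕ)
      [ZMOD (p : ℤ) ^ 3] := by
  rw [← genApery_two_two, ← genApery_two_two]
  exact genApery_two_modEq_mul_prime hp h3 2 n

/-- Gessel's Theorem 3 (i) in divisibility form: `p³ ∣ a_{np} − a_n` for a prime `p > 3`.
[cite: Gessel1982, Thm 3 (i)] -/
theorem pow_three_dvd_aperyNumber_mul_prime_sub (hp : p.Prime) (h3 : 3 < p) (n : ℕ) :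
    (p : ℤ) ^ 3 ∣ (AperyNumbers.aperyNumber (n * p) : ℤ) - (AperyNumbers.aperyNumber n : ℤ) :=
  (aperyNumber_modEq_mul_prime hp h3 n).symm.dvd

/-- **The `ζ(2)` companion (Coster 1988)**: for a prime `p > 3` and every `n`, `u_{pn} ≡ u_n (mod p³)`
for Apéry's `ζ(2)` numbers `u_n = Σ_k C(n,k)² C(n+k,k)` (Zagier's sporadic case D; the case `r = 1` of
Coster's `u(mp^r) ≡ u(mp^{r−1}) (mod p^{3r})`).
[cite: Coster1988, (two-term supercongruence, case D, r = 1)] [cite: OsburnSahuStraub2016, §4]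
[cite: Straub2014, (25) (diagonal case, r = 1)] -/
theorem apery2Number_modEq_mul_prime (hp : p.Prime) (h3 : 3 < p) (n : ℕ) :
    ((AperyNumbersZetaTwo.apery2Number (n * p) : ℕ) : ℤ) ≡ (AperyNumbersZetaTwo.apery2Number n : ℕ)
      [ZMOD (p : ℤ) ^ 3] := by
  rw [← genApery_two_one, ← genApery_two_one]
  exact genApery_two_modEq_mul_prime hp h3 1 n

/-- The `ζ(2)` companion in divisibility form: `p³ ∣ u_{np} − u_n` for a prime `p > 3`.
[cite: Straub2014, (25) (diagonal case, r = 1)] -/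
theorem pow_three_dvd_apery2Number_mul_prime_sub (hp : p.Prime) (h3 : 3 < p) (n : ℕ) :
    (p : ℤ) ^ 3 ∣ (AperyNumbersZetaTwo.apery2Number (n * p) : ℤ)
      - (AperyNumbersZetaTwo.apery2Number n : ℤ) :=
  (apery2Number_modEq_mul_prime hp h3 n).symm.dvd

/-- Term-level digit congruence for the Apéry numbers: `p³ ∣ C(np,jp)²C(np+jp,jp)² − C(n,j)²C(n+j,j)²`
for a prime `p > 3` (Gessel's `S₁`, termwise). [cite: Gessel1982, Thm 3 (proof)] -/
theorem pow_three_dvd_aperyTerm_digit_sub (hp : p.Prime) (h3 : 3 < p) (n j : ℕ) :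
    (p : ℤ) ^ 3 ∣ (AperyNumbers.aperyTerm (n * p) (j * p) : ℤ) - (AperyNumbers.aperyTerm n j : ℤ) := by
  have h := (choose_digit_term_modEq hp h3 2 n j).symm.dvd
  unfold AperyNumbers.aperyTerm
  push_cast
  exact h

/-- Term-level off-digit congruence for the Apéry numbers: for a prime `p > 3` and `j < n`,
`p³ ∣ Σ_{0<i<p} C(np,jp+i)² C(np+jp+i,jp+i)²` (Gessel's `S₂`, blockwise).
[cite: Gessel1982, Thm 3 (proof)] -/
theorem pow_three_dvd_sum_aperyTerm_offDigit (hp : p.Prime) (h3 : 3 < p) {n j : ℕ} (hjn : j < n) :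
    (p : ℤ) ^ 3 ∣ ∑ i ∈ Ico 1 p, (AperyNumbers.aperyTerm (n * p) (j * p + i) : ℤ) := by
  have h := Int.natCast_dvd_natCast.2 (pow_three_dvd_offDigit_block hp h3 2 hjn)
  unfold AperyNumbers.aperyTerm
  push_cast at h ⊢
  exact h

end main

end Literature.Combinatorics.Enumerative.AperySupercongruences
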